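import Literature.NumberTheory.EllipticCurves.PastenCongruenceModulusSizeProofs
import HarnessLib

/-!
# Effective multiplicity one at two levels in Sturm form, with a polynomial window

Helper (`--supports`) for the crux `Summit.ABC.ABC.Theses.IsogenyGlueCongruence.PolyFreyMazurPairs`
(stmt-ABC-2047), line `sturm-window-effective-smo`, stub `stub_sturmTwoLevel`.

**Statement (`stub_sturmTwoLevel`).** Let `f ∈ S₂(Γ₀(N))`, `g ∈ S₂(Γ₀(N'))` be newforms
(`IsNewform0`: new, Hecke eigenform, `a₁ = 1`) whose Fourier coefficients agree at every prime
`p ∤ N N'` with `p ≤ (N N')³`. Then `aₙ(f) = aₙ(g)` for **every** `n` prime to `N N'`.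

**Proof** (the two-level port of the tree's one-level-pair theorem
`IsNewform0.coeff_eq_of_coprime_of_forall_prime_lt_sturm` of
`Literature/NumberTheory/EllipticCurves/PastenCongruenceModulusSizeProofs.lean`, there with `g` of
level `M ∣ N`; here both levels divide `L := N N'`).

1. *Two-level truncated Hecke recursion* (`coeff_eq_of_coprime_of_lt_twoLevel`): if
   `a_p(f) = a_p(g)` for the primes `p ∤ L` below `B`, then `aₙ(f) = aₙ(g)` for all `n < B`
   prime to `L`, by strong induction on `n` through
   `a_{pm} = a_p a_m − 𝟙(p ∤ level) p^{k−1} a_{m/p}` at both levels (`IsNewform0.coeff_prime_mul`,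
   Diamond–Shurman Prop. 5.8.5).
2. *Sieve and Sturm* (`coeff_eq_of_coprime_of_forall_prime_lt_sturm_twoLevel`): lift both forms
   to level `L` (`toLevel0`, same `q`-expansion), sieve the difference at every prime `q ∣ L`
   (`exists_sieve_primes`) to a cusp form `H ∈ S_k(Γ₀(L · rad L))` with `aₙ(H) = aₙ(f) − aₙ(g)`
   for `(n, L) = 1` and `aₙ(H) = 0` otherwise; by step 1 its coefficients vanish below
   `B = ⌊k μ(L rad L)/12⌋ + 1`, so `H = 0` by the cuspidal Sturm bound
   (`cuspForm_eq_zero_of_qExpansion_coeff_eq_zero`, Sturm 1987 Thm. 1, with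
   `index_gamma0_eq_gamma0Index_holds`, `numCusps_eq_nuInfty_holds`, `ν_∞ ≥ 1`).
3. *The window* (`sturmWindow_two_le`): in weight `2`,
   `B − 1 = ⌊μ(L rad L)/6⌋ ≤ L ∏_{q ∣ L}(q + 1) ≤ L · rad(L)² ≤ L³`
   (`gamma0Index_mul_prod_primeFactors`, `q + 1 ≤ q²`, `rad L ∣ L`), so the hypothesis
   `p ≤ (N N')³` covers every prime `p < B`.

Everything used is proved in the tree; no named fact enters. Sources: J. Sturm, *On the congruence
of modular forms*, LNM 1240 (1987), Thm. 1; F. Diamond, J. Shurman, *A first course in modular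
forms*, GTM 228 (2005), Prop. 5.8.5. Not here: the neighbouring stubs of the line (modularity,
torsion transport, trace congruence) — they are neither used nor restated.
-/

-- `Summit.ABC.ABC` is the mandated summit-side namespace (CONVENTIONS §2); the duplicate is
-- deliberate.
set_option linter.dupNamespace false

noncomputable section

open scoped MatrixGroups ModularForm

namespace Summit.ABC.ABC.Theorems.PolyFreyMazurPairs

open Literature.NumberTheory.EllipticCurves.ModularForms CongruenceSubgroup UpperHalfPlane

/-! ## Step 1: the two-level truncated Hecke recursion -/

/-- **Two-level truncated Hecke recursion.** Newforms `f` (level `N`) and `g` (level `N'`), with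
`N ∣ L` and `N' ∣ L`, having the same `a_p` at the primes `p ∤ L` below `B`, have the same `aₙ` at
all `n < B` prime to `L` (Diamond–Shurman Prop. 5.8.5: `a_{pm} = a_p a_m − 𝟙(p) p^{k−1} a_{m/p}`,
`IsNewform0.coeff_prime_mul`; the merge of the tree's truncated one-level-pair
`IsNewform0.coeff_eq_of_coprime_of_lt` with its two-level untruncated
`IsNewform0.coeff_eq_of_coprime`).
[cite: DiamondShurman2005, Prop. 5.8.5] -/
theorem coeff_eq_of_coprime_of_lt_twoLevel {N N' : ℕ} [NeZero N] [NeZero N'] {k : ℤ}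
    {f : CuspForm (Gamma0 N) k} {g : CuspForm (Gamma0 N') k} (hf : IsNewform0 f)
    (hg : IsNewform0 g) {L : ℕ} (hNL : N ∣ L) (hN'L : N' ∣ L) {B : ℕ}
    (h : ∀ p : ℕ, p.Prime → ¬ p ∣ L → p < B →
      (qExpansion 1 ⇑f).coeff p = (qExpansion 1 ⇑g).coeff p)
    {n : ℕ} (hn : n.Coprime L) (hnB : n < B) :
    (qExpansion 1 ⇑f).coeff n = (qExpansion 1 ⇑g).coeff n := by
  -- adapted from `IsNewform0.coeff_eq_of_coprime_of_lt` / `IsNewform0.coeff_eq_of_coprime` (tree)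
  induction n using Nat.strong_induction_on with
  | _ n ih =>
    rcases Nat.lt_or_ge n 2 with hn2 | hn2
    · interval_cases n
      · rw [CuspFormClass.qExpansion_coeff_zero f one_pos (one_mem_strictPeriods_gamma0 N),
          CuspFormClass.qExpansion_coeff_zero g one_pos (one_mem_strictPeriods_gamma0 N')]
      · rw [show (qExpansion 1 ⇑f).coeff 1 = 1 from hf.2.2,
          show (qExpansion 1 ⇑g).coeff 1 = 1 from hg.2.2]
    · obtain ⟨p, hp, m, rfl⟩ : ∃ p, p.Prime ∧ ∃ m, n = p * m := by
        obtain ⟨p, hp, hpn⟩ := Nat.exists_prime_and_dvd (show n ≠ 1 by omega)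
        exact ⟨p, hp, hpn⟩
      have hpL : ¬ p ∣ L :=
        (Nat.Prime.coprime_iff_not_dvd hp).mp (Nat.Coprime.coprime_dvd_left (dvd_mul_right p m) hn)
      have hpN : ¬ p ∣ N := fun h' ↦ hpL (h'.trans hNL)
      have hpN' : ¬ p ∣ N' := fun h' ↦ hpL (h'.trans hN'L)
      have hm : m.Coprime L := Nat.Coprime.coprime_mul_left hn
      have hm0 : 0 < m := Nat.pos_of_ne_zero (by rintro rfl; simp at hn2)
      have hmlt : m < p * m := lt_mul_left hm0 hp.one_lt
      have hpB : p < B := lt_of_le_of_lt (Nat.le_mul_of_pos_right p hm0) hnB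
      rw [hf.coeff_prime_mul hp m, hg.coeff_prime_mul hp m, if_neg hpN, if_neg hpN', h p hp hpL hpB,
        ih m hmlt hm (hmlt.trans hnB)]
      split_ifs with hpm
      · rw [ih (m / p) ((Nat.div_le_self m p).trans_lt hmlt)
          (Nat.Coprime.coprime_dvd_left (Nat.div_dvd_of_dvd hpm) hm)
          (((Nat.div_le_self m p).trans_lt hmlt).trans hnB)]
      · rfl

/-! ## Step 2: sieve to level `L · rad L` and the cuspidal Sturm bound -/

/-- **Quantitative multiplicity one at two levels, prime to a common multiple of the levels.**
Let `f ∈ S_k(Γ₀(N))` and `g ∈ S_k(Γ₀(N'))` be newforms, `N ∣ L`, `N' ∣ L` (`L ≥ 1`), whose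
coefficients `a_p` agree at every prime `p ∤ L` below `B = ⌊k μ(L rad L)/12⌋ + 1`,
`μ = [SL₂(ℤ) : Γ₀(L rad L)]` (`gamma0Index`, `rad L = ∏_{q ∣ L} q`). Then `aₙ(f) = aₙ(g)` for
**all** `n` prime to `L`: the sieved difference
`H = ∑_{(n,L)=1} (aₙ(f) − aₙ(g)) qⁿ ∈ S_k(Γ₀(L rad L))` (`exists_sieve_primes` applied to
`toLevel0 f − toLevel0 g`) has `aₙ(H) = 0` for `n < B`
(`coeff_eq_of_coprime_of_lt_twoLevel`), hence vanishes by the cuspidal Sturm bound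
(`cuspForm_eq_zero_of_qExpansion_coeff_eq_zero`, Sturm 1987, Thm. 1, with
`index_gamma0_eq_gamma0Index_holds`, `numCusps_eq_nuInfty_holds`). The two-level port of the tree's
`IsNewform0.coeff_eq_of_coprime_of_forall_prime_lt_sturm`. [cite: Sturm1987, Thm. 1] -/
theorem coeff_eq_of_coprime_of_forall_prime_lt_sturm_twoLevel {N N' : ℕ} [NeZero N] [NeZero N']
    {k : ℤ} {f : CuspForm (Gamma0 N) k} {g : CuspForm (Gamma0 N') k} (hf : IsNewform0 f)
    (hg : IsNewform0 g) {L : ℕ} [NeZero L] (hNL : N ∣ L) (hN'L : N' ∣ L)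
    (h : ∀ p : ℕ, p.Prime → ¬ p ∣ L →
      p < (k * gamma0Index (L * ∏ q ∈ L.primeFactors, q)).toNat / 12 + 1 →
      (qExpansion 1 ⇑f).coeff p = (qExpansion 1 ⇑g).coeff p)
    {n : ℕ} (hn : n.Coprime L) :
    (qExpansion 1 ⇑f).coeff n = (qExpansion 1 ⇑g).coeff n := by
  -- adapted from `IsNewform0.coeff_eq_of_coprime_of_forall_prime_lt_sturm` (tree)
  set L' := L * ∏ q ∈ L.primeFactors, q with hL'
  have hL'0 : L' ≠ 0 := mul_ne_zero (NeZero.ne L)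
    (Finset.prod_ne_zero_iff.mpr fun q hq ↦ (Nat.prime_of_mem_primeFactors hq).ne_zero)
  haveI : NeZero L' := ⟨hL'0⟩
  set d : CuspForm (Gamma0 L) k := toLevel0 hNL k f - toLevel0 hN'L k g with hd
  have hdcoeff : ∀ m, (qExpansion 1 ⇑d).coeff m =
      (qExpansion 1 ⇑f).coeff m - (qExpansion 1 ⇑g).coeff m := fun m ↦ by
    rw [hd, qExpansion_coeff_sub_level0, qExpansion_toLevel0, qExpansion_toLevel0]
  obtain ⟨H, hH⟩ := exists_sieve_primes (k := k) L.primeFactors L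
    (fun q hq ↦ ⟨Nat.prime_of_mem_primeFactors hq, Nat.dvd_of_mem_primeFactors hq⟩) d
  -- `a_i(H) = 0` for `i < B`
  have hHB : ∀ i < (k * gamma0Index L').toNat / 12 + 1, (qExpansion 1 ⇑H).coeff i = 0 := by
    intro i hi
    rw [hH i]
    split_ifs with hcop
    · rw [hdcoeff, coeff_eq_of_coprime_of_lt_twoLevel hf hg hNL hN'L h
        ((coprime_iff_forall_mem_primeFactors_not_dvd (N := L)).mpr hcop) hi, sub_self]
    · rfl
  -- Sturm at level `L' = L rad L`
  have hH0 : H = 0 := by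
    refine cuspForm_eq_zero_of_qExpansion_coeff_eq_zero (one_mem_strictPeriods_coe_gamma0 L') H
      hHB ?_
    rw [card_quotient_subgroupOf_eq_index, index_gamma0_eq_gamma0Index_holds L']
    have hc : Nat.card (CuspOrbits (Gamma0 L' : Subgroup (GL (Fin 2) ℝ))) = nuInfty L' :=
      numCusps_eq_nuInfty_holds L'
    rw [hc]
    have h1 := one_le_nuInfty L'
    omega
  have key := hH n
  rw [hH0, if_pos ((coprime_iff_forall_mem_primeFactors_not_dvd (N := L)).mp hn), hdcoeff]
    at key
  have h0 : (qExpansion 1 ⇑(0 : CuspForm (Gamma0 L') k)).coeff n = 0 := by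
    simp [CuspForm.coe_zero, qExpansion_zero]
  rw [h0] at key
  exact sub_eq_zero.mp key.symm

/-! ## Step 3: the weight-two Sturm window at level `L · rad L` lies below `L³` -/

/-- **The window.** For `L ≥ 1`, `⌊2 μ(L rad L)/12⌋ ≤ L³`, where
`μ(L rad L) = [SL₂(ℤ) : Γ₀(L rad L)] = L ∏_{q ∣ L}(q + 1)` (`gamma0Index_mul_prod_primeFactors`) and
`∏_{q ∣ L}(q + 1) ≤ ∏_{q ∣ L} q² = rad(L)² ≤ L²` (`q + 1 ≤ q²` for primes, `rad L ∣ L`).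
[folklore] -/
theorem sturmWindow_two_le {L : ℕ} (hL : L ≠ 0) :
    ((2 : ℤ) * gamma0Index (L * ∏ q ∈ L.primeFactors, q)).toNat / 12 ≤ L ^ 3 := by
  rw [gamma0Index_mul_prod_primeFactors hL]
  have hprod : ∏ q ∈ L.primeFactors, (q + 1) ≤ L ^ 2 :=
    calc ∏ q ∈ L.primeFactors, (q + 1) ≤ ∏ q ∈ L.primeFactors, q ^ 2 :=
          Finset.prod_le_prod (fun q _ ↦ Nat.zero_le _) fun q hq ↦ by
            have hq2 : 2 ≤ q := (Nat.prime_of_mem_primeFactors hq).two_le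
            nlinarith
      _ = (∏ q ∈ L.primeFactors, q) ^ 2 := Finset.prod_pow _ 2 _
      _ ≤ L ^ 2 := Nat.pow_le_pow_left
          (Nat.le_of_dvd (Nat.pos_of_ne_zero hL) (Nat.prod_primeFactors_dvd L)) 2
  have hcast : ((2 : ℤ) * ((L * ∏ q ∈ L.primeFactors, (q + 1) : ℕ) : ℤ)).toNat =
      2 * (L * ∏ q ∈ L.primeFactors, (q + 1)) := by
    rw [show ((2 : ℤ) * ((L * ∏ q ∈ L.primeFactors, (q + 1) : ℕ) : ℤ)) =
      ((2 * (L * ∏ q ∈ L.primeFactors, (q + 1)) : ℕ) : ℤ) by push_cast; ring, Int.toNat_natCast]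
  rw [hcast]
  have hle : L * ∏ q ∈ L.primeFactors, (q + 1) ≤ L ^ 3 :=
    calc L * ∏ q ∈ L.primeFactors, (q + 1) ≤ L * L ^ 2 := Nat.mul_le_mul_left L hprod
      _ = L ^ 3 := by ring
  omega

/-! ## The stub -/

/-- **stub `stub_sturmTwoLevel` of line `sturm-window-effective-smo` (crux `PolyFreyMazurPairs`,
stmt-ABC-2047): effective multiplicity one at two levels with a polynomial Sturm window.**
Let `f ∈ S₂(Γ₀(N))`, `g ∈ S₂(Γ₀(N'))` be newforms (`IsNewform0`) whose coefficients agree at every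
prime `p ∤ N N'` with `p ≤ (N N')³`. Then `aₙ(f) = aₙ(g)` for every `n` prime to `N N'`:
`coeff_eq_of_coprime_of_forall_prime_lt_sturm_twoLevel` with `L = N N'`, whose Sturm window
`p < ⌊2 μ(L rad L)/12⌋ + 1` lies inside `p ≤ L³` (`sturmWindow_two_le`). Sturm 1987, Thm. 1;
Diamond–Shurman Prop. 5.8.5. [cite: Sturm1987, Thm. 1] -/
theorem stub_sturmTwoLevel : ∀ (N N' : ℕ) [NeZero N] [NeZero N']
    (f : CuspForm (CongruenceSubgroup.Gamma0 N) 2) (g : CuspForm (CongruenceSubgroup.Gamma0 N') 2),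
    IsNewform0 f → IsNewform0 g →
    (∀ p : ℕ, p.Prime → ¬ p ∣ N * N' → p ≤ (N * N') ^ 3 → cuspCoeff f p = cuspCoeff g p) →
    ∀ n : ℕ, n.Coprime (N * N') → cuspCoeff f n = cuspCoeff g n := by
  intro N N' _ _ f g hf hg h n hn
  haveI : NeZero (N * N') := ⟨mul_ne_zero (NeZero.ne N) (NeZero.ne N')⟩
  have hwin := sturmWindow_two_le (NeZero.ne (N * N'))
  exact coeff_eq_of_coprime_of_forall_prime_lt_sturm_twoLevel hf hg (dvd_mul_right N N')
    (dvd_mul_left N' N) (fun p hp hpL hpB ↦ h p hp hpL (by omega)) hn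

end Summit.ABC.ABC.Theorems.PolyFreyMazurPairs

end
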